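import Literature.NumberTheory.Transcendental.RoyRankGenericMaps
import HarnessLib

/-!
# Roy 1992 over a general field: §2 — the functions `a, …, d₁` and the dictionary with Theorem 2

Theorem-only support file (no definitions, no facts) for the field-generic deduction
`RoyRank.Thm1 F L ω → RoyRank.Thm2 F L ω` (Roy's Theorem 2 from M. Waldschmidt's Theorem 1,
[Roy1992] §§2–3) over the data of `Literature.NumberTheory.Transcendental.RoyRankGenericDefs`, on
the objects `RoyRank.Obj F L`, morphisms, kernels/cokernels, image objects and functions
`fa ω, fb, fc, fd, fr, fd₀, fd₁` of `Literature.NumberTheory.Transcendental.RoyRankGenericApparatus`.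
It is the field-generic form of the second half of the tree's `K = ℂ` companion
`Literature.Barriers.Schanuel.AlgebraicIndependenceOfLogarithmsRoyCategory`:

* the values of the functions in `ℝ` (`Obj.cast_fa`, `cast_fb`, `cast_fb_add_fd`), `a ≤ d₁`
  (first assertion of Proposition 3), `b(X) ≠ 0 ↔ V ≠ K^{d₀} × K^{d₁}`,
  `b + d ≠ 0 ↔ W ≠ K^{d₀} × K^{d₁}`;
* the dictionary between the language of Theorem 2bis and that of Theorem 2: the ratio
  `d₁(X')/b(X')` is `d₁'/(d₀' + d₁' − dim_K(s(V)))` (`Obj.thm2Ratio_eq`); "there does not exist in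
  `𝒞` any kernel `i : X* → X'` with codomain `X'` such that `d₁(X*) = b(X*) = 0` and `r(X*) ≠ 0`" is
  "`s(V) ∩ (F^{d₀'} × 0) = 0`" (`Obj.noBadKernel_iff`: a bad kernel sends `(e₁, 0)` to a non-zero
  point of `s(V) ∩ (F^{d₀'} × 0)`; conversely such a point `v` gives the bad kernel
  `K¹ × K⁰ → K^{d₀'} × K^{d₁'}`, `t ↦ t v`); the minimality of Theorem 2 is the minimality of Theorem
  2bis (`Obj.IsCokerMap.isThm2Minimal_iff`);
* Theorem 1bis object by object (`Obj.exists_mapObj_of_thm1`: `Thm1 F L ω` gives, for `b(X) ≠ 0`,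
  an admissible `s` with `b(X') + d(X') ≠ 0` and `(a(X') + c(X'))/(b(X') + d(X')) ≤ a(X)/b(X)` for
  `X' = s(X)`).

## References

* [Roy1992] D. Roy, *Matrices whose coefficients are linear forms in logarithms*, J. Number Theory
  41 (1992) 22–47: §1 Theorems 1–2 (p. 25); §2 (pp. 26–27: the functions, Theorems 1bis, 2bis;
  Proposition 3 p. 28).
-/

noncomputable section

open Module Submodule

namespace Literature.NumberTheory.Transcendental.RoyRank

variable {K : Type*} [Field K] [CharZero K]
variable {F : IntermediateField ℚ K} {L : Submodule ℚ K} {ω : K}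
variable {d₀ d₁ d₀' d₁' : ℕ}

/-! ### Dimensions -/

omit [CharZero K] in
/-- `dim_K (K^{d₀} × K^{d₁}) = d₀ + d₁`. [folklore] -/
theorem finrank_linTangent (d₀ d₁ : ℕ) : finrank K (LinTangent K d₀ d₁) = d₀ + d₁ := by
  rw [Module.finrank_prod, Module.finrank_fin_fun, Module.finrank_fin_fun]

/-- `Ω` is finite dimensional over `ℚ`. [folklore] -/
theorem finiteDimensional_omega (ω : K) (d₀ d₁ : ℕ) : FiniteDimensional ℚ (Omega ω d₀ d₁ :
    Submodule ℚ (LinTangent K d₀ d₁)) :=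
  FiniteDimensional.span_of_finite ℚ (Set.finite_range _)

/-- `dim_ℚ Ω ≤ d₁`. [folklore] -/
theorem finrank_omega_le (ω : K) (d₀ d₁ : ℕ) :
    finrank ℚ (Omega ω d₀ d₁ : Submodule ℚ (LinTangent K d₀ d₁)) ≤ d₁ := by
  unfold Omega
  exact (finrank_range_le_card _).trans (by simp)

namespace Obj

variable (X : Obj F L)

/-- `dim_K V ≤ d₀ + d₁`. [folklore] -/
theorem finrank_V_le : finrank K X.V ≤ X.d₀ + X.d₁ := by
  rw [← finrank_linTangent (K := K)]
  exact Submodule.finrank_le _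

/-- `dim_K W ≤ dim_K V`. [folklore] -/
theorem finrank_W_le : finrank K X.W ≤ finrank K X.V :=
  Submodule.finrank_mono X.hWV

/-- `dim_ℚ(Y ∩ Ω) ≤ d₁`. [folklore] -/
theorem finrank_Y_inf_omega_le (ω : K) : finrank ℚ ↥(X.Y ⊓ Omega ω X.d₀ X.d₁) ≤ X.d₁ := by
  haveI := finiteDimensional_omega ω X.d₀ X.d₁
  refine le_trans ?_ (finrank_omega_le ω X.d₀ X.d₁)
  exact LinearMap.finrank_le_finrank_of_injective
    (Submodule.inclusion_injective (inf_le_right : X.Y ⊓ Omega ω X.d₀ X.d₁ ≤ _))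

/-- `a(X)` in `ℝ`. [folklore] -/
theorem cast_fa (ω : K) :
    ((fa ω X : ℕ) : ℝ) = (X.d₁ : ℝ) - finrank ℚ ↥(X.Y ⊓ Omega ω X.d₀ X.d₁) := by
  unfold fa
  rw [Nat.cast_sub (X.finrank_Y_inf_omega_le ω)]

/-- `b(X)` in `ℝ`. [folklore] -/
theorem cast_fb : ((fb X : ℕ) : ℝ) = (X.d₀ : ℝ) + X.d₁ - finrank K X.V := by
  unfold fb
  rw [Nat.cast_sub X.finrank_V_le, Nat.cast_add]

/-- `b(X) + d(X) = d₀ + d₁ − dim_K W` in `ℝ`. [folklore] -/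
theorem cast_fb_add_fd : ((fb X : ℕ) : ℝ) + fd X = (X.d₀ : ℝ) + X.d₁ - finrank K X.W := by
  unfold fd
  rw [cast_fb, Nat.cast_sub X.finrank_W_le]
  ring

/-- `a(X) ≤ d₁(X)` (first assertion of Proposition 3). [cite: Roy1992, §2 Proposition 3 (p. 28)] -/
theorem fa_le_fd₁ (ω : K) : fa ω X ≤ fd₁ X := Nat.sub_le _ _

/-- `b(X) ≠ 0 ↔ V ≠ K^{d₀} × K^{d₁}`. [folklore] -/
theorem fb_ne_zero_iff : fb X ≠ 0 ↔ X.V ≠ ⊤ := by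
  unfold fb
  constructor
  · intro h hV
    apply h
    rw [hV, finrank_top, finrank_linTangent, Nat.sub_self]
  · intro hV h
    apply hV
    apply Submodule.eq_top_of_finrank_eq
    rw [finrank_linTangent]
    have := X.finrank_V_le
    omega

/-- `b(X') + d(X') ≠ 0 ↔ W' ≠ K^{d₀'} × K^{d₁'}`. [folklore] -/
theorem fb_add_fd_ne_zero_iff : fb X + fd X ≠ 0 ↔ X.W ≠ ⊤ := by
  unfold fb fd
  have h1 := X.finrank_V_le
  have h2 := X.finrank_W_le
  constructor
  · intro h hW
    apply h
    have : finrank K X.W = X.d₀ + X.d₁ := by rw [hW, finrank_top, finrank_linTangent]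
    omega
  · intro hW h
    apply hW
    apply Submodule.eq_top_of_finrank_eq
    rw [finrank_linTangent]
    omega

/-- **The ratio of Theorem 2 is `d₁(X')/b(X')`**: for a cokernel `(X, X', s)`,
`d₁'/(d₀' + d₁' − dim_K(s(V))) = d₁(X')/b(X')`. [cite: Roy1992, §2 Theorem 2bis (p. 27)] -/
theorem thm2Ratio_eq {X X' : Obj F L} {s : LinTangent K X.d₀ X.d₁ →ₗ[K] LinTangent K X'.d₀ X'.d₁}
    (hs : X.IsCokerMap X' s) : thm2Ratio X.V X'.d₀ X'.d₁ s = (fd₁ X' : ℝ) / fb X' := by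
  rw [cast_fb, thm2Ratio, ← hs.2.2.2]
  rfl

/-! ### Bad kernels versus `s(V) ∩ (F^{d₀'} × 0) = 0` -/

/-- Every `K`-subspace of `K¹ × K⁰` is rational over `F` (it is `0` or spanned by `(1, 0)`). [folklore] -/
theorem isFRational_of_one_zero (T : Submodule K (LinTangent K 1 0)) : IsFRational F T := by
  unfold IsFRational
  refine le_antisymm (fun u hu => ?_) (Submodule.span_le.2 fun v hv => hv.1)
  by_cases hu0 : u.1 0 = 0
  · have : u = 0 := by
      ext i
      · rw [Subsingleton.elim i 0, hu0]; rfl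
      · exact Fin.elim0 i
    rw [this]
    exact Submodule.zero_mem _
  · -- `e = (u.1 0)⁻¹ • u = (1, 0)` is an `F`-point of `T` and `u = (u.1 0) • e`
    set e : LinTangent K 1 0 := (u.1 0)⁻¹ • u with he
    have heT : e ∈ T := Submodule.smul_mem _ _ hu
    have heq : IsFPoint F e := by
      refine ⟨fun i => ?_, fun j => Fin.elim0 j⟩
      rw [Subsingleton.elim i 0, he, Prod.smul_fst, Pi.smul_apply, smul_eq_mul,
        inv_mul_cancel₀ hu0]
      exact one_mem _
    have hu : u = (u.1 0) • e := by
      rw [he, smul_smul, mul_inv_cancel₀ hu0, one_smul]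
    rw [hu]
    exact Submodule.smul_mem _ _ (Submodule.subset_span ⟨heT, heq⟩)

/-- **"No kernel `i : X* → X'` with `d₁(X*) = b(X*) = 0` and `r(X*) ≠ 0`" is
"`V' ∩ (F^{d₀'} × 0) = 0`"** (the translation between Theorem 2bis and Theorem 2): such a kernel has
`V* = K^{d₀*} × K^{d₁*}` with `d₀* > 0` and sends `(e₁, 0)` to a non-zero point of
`V' ∩ (F^{d₀'} × 0)`; conversely a non-zero `v ∈ V' ∩ (F^{d₀'} × 0)` gives the kernel
`K¹ × K⁰ → K^{d₀'} × K^{d₁'}`, `t ↦ t v`, with `d₁(X*) = 0`, `b(X*) = 0`, `r(X*) = 1`.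
[cite: Roy1992, §1 Theorem 2 (p. 25) and §2 Theorem 2bis (p. 27)] -/
theorem noBadKernel_iff (X' : Obj F L) :
    (¬ ∃ (A : Obj F L) (i : LinTangent K A.d₀ A.d₁ →ₗ[K] LinTangent K X'.d₀ X'.d₁),
        A.IsKerMap X' i ∧ fd₁ A = 0 ∧ fb A = 0 ∧ fr A ≠ 0) ↔
      ∀ v ∈ X'.V, (∀ k, v.1 k ∈ F) → v.2 = 0 → v = 0 := by
  constructor
  · intro hno v hvV hv1 hv2
    by_contra hv0
    apply hno
    -- the kernel `K¹ × K⁰ → K^{d₀'} × K^{d₁'}`, `(t, u) ↦ t 0 • v`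
    let i : LinTangent K 1 0 →ₗ[K] LinTangent K X'.d₀ X'.d₁ :=
      (LinearMap.proj (0 : Fin 1) ∘ₗ LinearMap.fst K (Fin 1 → K) (Fin 0 → K)).smulRight v
    have hi : ∀ q : LinTangent K 1 0, i q = q.1 0 • v := fun q => rfl
    have hinj : Function.Injective i := by
      rw [injective_iff_map_eq_zero]
      intro q hq
      rw [hi, smul_eq_zero] at hq
      rcases hq with hq | hq
      · ext k
        · rw [Subsingleton.elim k 0, hq]; rfl
        · exact Fin.elim0 k
      · exact absurd hq hv0
    have hbi : IsBiRational F i := by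
      refine ⟨fun x hx => ⟨fun k => ?_, ?_⟩, fun y _ => ⟨?_, fun j => ⟨0, ?_⟩⟩⟩
      · rw [hi, Prod.smul_fst, Pi.smul_apply, smul_eq_mul]
        exact mul_mem (hx 0) (hv1 k)
      · rw [hi, Prod.smul_snd, hv2, smul_zero]
      · rw [hi]; simp
      · rw [hi]; simp
    -- some coordinate of `v.1` is a non-zero element of `F`
    obtain ⟨k₀, hk₀⟩ : ∃ k, v.1 k ≠ 0 := by
      by_contra hall
      simp only [not_exists, not_not] at hall
      exact hv0 (Prod.ext (funext hall) hv2)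
    haveI := X'.finite
    let A : Obj F L :=
      { d₀ := 1
        d₁ := 0
        Y := X'.Y.comap (i.restrictScalars ℚ)
        W := X'.W.comap i
        V := X'.V.comap i
        finite := by
          refine Module.Finite.of_injective
            ((i.restrictScalars ℚ).restrict (p := X'.Y.comap (i.restrictScalars ℚ)) (q := X'.Y)
              fun x hx => hx) ?_
          intro x y hxy
          apply Subtype.ext
          apply hinj
          have := congrArg Subtype.val hxy
          simpa using this
        isLog := by
          intro y hy
          refine ⟨fun k => ?_, fun j => Fin.elim0 j⟩
          rw [Subsingleton.elim k 0]
          have hmem : (i y).1 k₀ ∈ F := (X'.isLog _ hy).1 k₀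
          rw [hi, Prod.smul_fst, Pi.smul_apply, smul_eq_mul] at hmem
          have : y.1 0 = y.1 0 * v.1 k₀ * (v.1 k₀)⁻¹ := by
            rw [mul_assoc, mul_inv_cancel₀ hk₀, mul_one]
          rw [this]
          exact mul_mem hmem (inv_mem (hv1 k₀))
        isRat := isFRational_of_one_zero _
        hYV := fun y hy => X'.hYV hy
        hWV := Submodule.comap_mono X'.hWV }
    have hAV : A.V = ⊤ := by
      rw [eq_top_iff]
      intro q _
      show i q ∈ X'.V
      rw [hi]
      exact Submodule.smul_mem _ _ hvV
    refine ⟨A, i, ⟨hinj, hbi, rfl, rfl, rfl⟩, rfl, ?_, ?_⟩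
    · show 1 + 0 - finrank K A.V = 0
      rw [hAV, finrank_top, finrank_linTangent]
      rfl
    · show (1 : ℕ) + 0 ≠ 0
      norm_num
  · rintro h ⟨A, i, ⟨hinj, hbi, -, -, hAV⟩, hd₁, hb, hr⟩
    have hd₀ : 0 < A.d₀ := by
      change A.d₁ = 0 at hd₁
      unfold fr at hr
      omega
    -- `V* = K^{d₀*} × K^{d₁*}`
    have hVtop : A.V = ⊤ := by
      apply Submodule.eq_top_of_finrank_eq
      rw [finrank_linTangent]
      have := A.finrank_V_le
      unfold fb at hb
      omega
    -- `(e₁, 0) ↦` a non-zero point of `V' ∩ (F^{d₀'} × 0)`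
    set e : LinTangent K A.d₀ A.d₁ := (Pi.single ⟨0, hd₀⟩ 1, 0) with he
    have healg : ∀ k, (Pi.single (⟨0, hd₀⟩ : Fin A.d₀) (1 : K) : Fin A.d₀ → K) k ∈ F := by
      intro k
      by_cases hk : k = ⟨0, hd₀⟩
      · subst hk; simp
      · simp [hk]
    obtain ⟨h1, h2⟩ := hbi.1 _ healg
    have heV : i e ∈ X'.V := by
      have : e ∈ A.V := by rw [hVtop]; trivial
      rwa [hAV] at this
    have hie : i e = 0 := h _ heV h1 h2
    have he0 : e = 0 := hinj (by rw [hie, map_zero])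
    have := congrArg (fun q : LinTangent K A.d₀ A.d₁ => q.1 ⟨0, hd₀⟩) he0
    simp [he] at this

/-! ### Theorem 1bis and the minimality condition of Theorem 2, object by object -/

/-- For a cokernel `(X, X', s)`: `b(X') ≠ 0 ↔ s(V) ≠ K^{d₀'} × K^{d₁'}`. [folklore] -/
theorem IsCokerMap.fb_ne_zero_iff {X X' : Obj F L}
    {s : LinTangent K X.d₀ X.d₁ →ₗ[K] LinTangent K X'.d₀ X'.d₁}
    (hs : X.IsCokerMap X' s) : fb X' ≠ 0 ↔ X.V.map s ≠ ⊤ := by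
  rw [Obj.fb_ne_zero_iff, hs.2.2.2]

/-- **Theorem 1bis from Theorem 1**, object by object: if `b(X) ≠ 0` (i.e. `V ≠ K^{d₀} × K^{d₁}`),
`Thm1 F L ω` gives an admissible `s` with, for `X' = s(X)`, `b(X') + d(X') ≠ 0` and
`(a(X') + c(X'))/(b(X') + d(X')) ≤ a(X)/b(X)`. [cite: Roy1992, §2 Theorem 1bis (p. 27)] -/
theorem exists_mapObj_of_thm1 (h : Thm1 F L ω) (X : Obj F L) (hb : fb X ≠ 0) :
    ∃ (d₀' d₁' : ℕ) (s : LinTangent K X.d₀ X.d₁ →ₗ[K] LinTangent K d₀' d₁') (hs : IsAdmissible F s),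
      fb (X.mapObj s hs.2) + fd (X.mapObj s hs.2) ≠ 0 ∧
        ((fa ω (X.mapObj s hs.2) : ℝ) + fc (X.mapObj s hs.2)) /
            ((fb (X.mapObj s hs.2) : ℝ) + fd (X.mapObj s hs.2)) ≤ (fa ω X : ℝ) / fb X := by
  obtain ⟨d₀', d₁', s, hs, hW, hineq⟩ :=
    h X.d₀ X.d₁ X.Y X.W X.V X.finite X.isLog X.isRat X.hYV X.hWV ((fb_ne_zero_iff X).1 hb)
  refine ⟨d₀', d₁', s, hs, ?_, ?_⟩
  · rw [fb_add_fd_ne_zero_iff]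
    exact hW
  · rw [cast_fb_add_fd, cast_fa, cast_fa, cast_fb]
    exact hineq

/-- **The minimality of Theorem 2 is the minimality of Theorem 2bis**: for a cokernel `(X, X', s)`,
`s` minimises `d₁'/(d₀' + d₁' − dim_K(s(V)))` among the admissible maps with `s(V) ≠ K^{d₀'} × K^{d₁'}`
(`IsThm2Minimal F`) iff `b(X') ≠ 0` and `d₁(X')/b(X') ≤ d₁(X'')/b(X'')` for every cokernel
`(X, X'', s'')` with `b(X'') ≠ 0`. [cite: Roy1992, §1 Theorem 2 (p. 25) and §2 Theorem 2bis (p. 27)] -/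
theorem IsCokerMap.isThm2Minimal_iff {X X' : Obj F L}
    {s : LinTangent K X.d₀ X.d₁ →ₗ[K] LinTangent K X'.d₀ X'.d₁} (hs : X.IsCokerMap X' s) :
    IsThm2Minimal F X.V X'.d₀ X'.d₁ s ↔
      fb X' ≠ 0 ∧ ∀ (X'' : Obj F L) (s'' : LinTangent K X.d₀ X.d₁ →ₗ[K] LinTangent K X''.d₀ X''.d₁),
        X.IsCokerMap X'' s'' → fb X'' ≠ 0 → (fd₁ X' : ℝ) / fb X' ≤ (fd₁ X'' : ℝ) / fb X'' := by
  constructor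
  · rintro ⟨-, htop, hmin⟩
    refine ⟨hs.fb_ne_zero_iff.2 htop, fun X'' s'' hs'' hb'' => ?_⟩
    rw [← thm2Ratio_eq hs, ← thm2Ratio_eq hs'']
    exact hmin X''.d₀ X''.d₁ s'' hs''.1 (hs''.fb_ne_zero_iff.1 hb'')
  · rintro ⟨hb', hmin⟩
    refine ⟨hs.1, hs.fb_ne_zero_iff.1 hb', fun d₀'' d₁'' s'' hs'' htop'' => ?_⟩
    have hc := X.isCokerMap_mapObj hs''
    have h := hmin _ s'' hc (hc.fb_ne_zero_iff.2 htop'')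
    rwa [← thm2Ratio_eq hs, ← thm2Ratio_eq hc] at h

end Obj

end Literature.NumberTheory.Transcendental.RoyRank
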